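import Mathlib
import Literature.Computability.AlgebraicComplexity.Hyperdeterminant
import Summits.ValiantsHypothesis.ValiantsHypothesis.Theorems.DetQPDetqpThesisStubWeightHAux
import Summits.ValiantsHypothesis.ValiantsHypothesis.Theorems.BorderApolarityBorelFixedBorderApolarityLowering
import Summits.ValiantsHypothesis.ValiantsHypothesis.Theorems.BorderApolarityFixedWitnessObstructionQPH0Elementary

/-!
# Crux `DetQP.DetqpThesis` (stmt-ValiantsHypothesis-0315), line `four-dimensional-determinant` —
# stub B2w (`stub_weightH`): a generic anti-dominant cocharacter of the torus of `H(n,m,ι)`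

For an injective placement `ι` of the `n⁴` array variables missing the padding variable `(0,0)`
we construct an integer weight `μ` on the `m²` matrix variables with the eight registered
properties of `stub_weightH` (nonnegative; injective; lowering a multi-index inside the used block
raises `μ`; unused variables weigh less than used ones and than the padding variable and decrease
along `p.1·m + p.2`; the padded hyperdeterminant is `μ`-homogeneous; equal weight in degree `≤ m`
forces equal character for every `H`-diagonal `d`; bounded).

Construction: base `R = 4m + 5`, `L = m²`; every variable weighs a sum of FOUR powers of `R`,
`μ v = Σ_{r<4} R^{G r v}` with `G r (ιI) = L + r n + (n-1-I_r)`, `G r (0,0) = L + 4n`,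
`G r p = L-1-(p.1 m + p.2)` for unused `p`.  The weight of an exponent `e` of degree `≤ m` is then
the base-`R` numeral whose digits (all `≤ 4m < R`, `wH_digit_le`) are the slot contents
`Σ_{I_r = i} e(ιI)`, `4 e(0,0)` and `4 e_p` (`wH_weight_eq_digitSum`, `bfba_digits_inj`), whence
injectivity (`wH_injective_of_content`) and genericity (`wH_char_eq_of_content`); homogeneity of the
padded hyperdeterminant is `wH_padded_hyperdet_weight`.  Proved here as `hd_weightH` (same
statement as the registered `stub_weightH`).  Folklore (cf. `bfba_exists_weight` for the padded
permanent, route BorderApolarity).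
-/

noncomputable section

open MvPolynomial
open scoped BigOperators

namespace Summit.ValiantsHypothesis.ValiantsHypothesis.Theorems.DetQPDetqpThesis.HdBorelFixed

set_option linter.dupNamespace false

open Literature.Computability.AlgebraicComplexity
open Summit.ValiantsHypothesis.ValiantsHypothesis.Theorems.DetQPDetqpThesis
  (wH_weight_eq_digitSum wH_digit_le wH_padded_hyperdet_weight wH_injective_of_content wH_char_eq_of_content)
open Summit.ValiantsHypothesis.ValiantsHypothesis.Theorems.BorderApolarityBorelFixedBorderApolarity
  (bfba_digits_inj bfba_weight_natCast bfba_sum_eq_degree bfba_lin_injective bfba_weight_single_one)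
open Summit.ValiantsHypothesis.ValiantsHypothesis.Theorems.BorderApolarityFixedWitnessObstructionQP
  (fst_mul_add_snd_lt)

/-- **Stub B2w — a generic anti-dominant cocharacter of the torus of `H(n,m,ι)`** (same statement
as the line's registered `stub_weightH`; see the module docstring for the construction). -/
theorem hd_weightH (n m : ℕ) [NeZero m]
    (ι : (Fin 4 → Fin n) → Fin m × Fin m) (hι : Function.Injective ι)
    (hℓ : ((0 : Fin m), (0 : Fin m)) ∉ Set.range ι) :
    ∃ μ : Fin m × Fin m → ℤ,
      (∀ v, 0 ≤ μ v) ∧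
      Function.Injective μ ∧
      (∀ I I' : Fin 4 → Fin n, (∀ r, I' r ≤ I r) → I ≠ I' → μ (ι I) < μ (ι I')) ∧
      (∀ p : Fin m × Fin m, p ∉ Set.range ι → p ≠ (0, 0) → ∀ I : Fin 4 → Fin n, μ p < μ (ι I)) ∧
      (∀ p : Fin m × Fin m, p ∉ Set.range ι → p ≠ (0, 0) → μ p < μ (0, 0)) ∧
      (∀ p q : Fin m × Fin m, p ∉ Set.range ι → p ≠ (0, 0) → q ∉ Set.range ι → q ≠ (0, 0) →
        (p.1 : ℕ) * m + (p.2 : ℕ) < (q.1 : ℕ) * m + (q.2 : ℕ) → μ q < μ p) ∧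
      (∃ ν₀ : ℤ, ∀ d ∈ (X ((0 : Fin m), (0 : Fin m)) ^ (m - n) *
          rename ι (hyperdet fun I : Fin 4 → Fin n => (X I : MvPolynomial (Fin 4 → Fin n) ℂ))).support,
        Finsupp.weight μ d = ν₀) ∧
      (∀ e e' : Fin m × Fin m →₀ ℕ, e.degree ≤ m → e'.degree ≤ m →
        Finsupp.weight μ e = Finsupp.weight μ e' →
        ∀ d : Fin m × Fin m → ℂ, (∀ v, d v ≠ 0) →
          (∃ t : Fin 4 → Fin n → ℂ, ∀ I : Fin 4 → Fin n, d (ι I) = ∏ r, t r (I r)) →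
          ∏ v ∈ e.support, d v ^ e v = ∏ v ∈ e'.support, d v ^ e' v) ∧
      (∃ hi : ℤ, ∀ e : Fin m × Fin m →₀ ℕ, e.degree ≤ m → Finsupp.weight μ e ≤ hi) := by
  classical
  have hm : 1 ≤ m := Nat.pos_of_ne_zero (NeZero.ne m)
  -- notation
  set L : ℕ := m * m with hL
  set R : ℕ := 4 * m + 5 with hR
  set Q : ℕ := L + 4 * n + 1 with hQ
  have hR1 : 1 < R := by omega
  have hR0 : 0 < R := by omega
  have hL1 : 1 ≤ L := Nat.one_le_iff_ne_zero.2 (by rw [hL]; exact Nat.mul_ne_zero (by omega) (by omega))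
  set rm : Fin m × Fin m → ℕ := fun v => (v.1 : ℕ) * m + (v.2 : ℕ) with hrm
  have hrmL : ∀ v, rm v < L := fun v => fst_mul_add_snd_lt v
  set G : Fin 4 → Fin m × Fin m → ℕ := fun r v =>
    if h : ∃ I, ι I = v then L + (r : ℕ) * n + (n - 1 - (h.choose r : ℕ))
    else if v = ((0 : Fin m), (0 : Fin m)) then L + 4 * n else L - 1 - rm v with hG
  set μn : Fin m × Fin m → ℕ := fun v => ∑ r, R ^ G r v with hμn
  -- values of `G`
  have hchoose : ∀ I : Fin 4 → Fin n, ∀ h : ∃ I', ι I' = ι I, h.choose = I :=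
    fun I h => hι h.choose_spec
  have GU : ∀ (r : Fin 4) (I : Fin 4 → Fin n), G r (ι I) = L + (r : ℕ) * n + (n - 1 - (I r : ℕ)) := by
    intro r I
    simp only [hG, dif_pos (⟨I, rfl⟩ : ∃ I', ι I' = ι I), hchoose]
  have G0 : ∀ r : Fin 4, G r ((0 : Fin m), (0 : Fin m)) = L + 4 * n := by
    intro r
    have h : ¬ ∃ I, ι I = ((0 : Fin m), (0 : Fin m)) := fun ⟨I, hI⟩ => hℓ ⟨I, hI⟩
    simp only [hG, dif_neg h, if_true]
  have Gp : ∀ (r : Fin 4) (p : Fin m × Fin m), p ∉ Set.range ι → p ≠ (0, 0) → G r p = L - 1 - rm p := by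
    intro r p hp hp0
    have h : ¬ ∃ I, ι I = p := fun ⟨I, hI⟩ => hp ⟨I, hI⟩
    simp only [hG, dif_neg h, if_neg hp0]
  have hGQ : ∀ r v, G r v < Q := by
    intro r v
    by_cases hv : v ∈ Set.range ι
    · obtain ⟨I, rfl⟩ := hv
      rw [GU]
      have hr : (r : ℕ) ≤ 3 := Nat.lt_succ_iff.1 r.isLt
      have h1 : (r : ℕ) * n ≤ 3 * n := Nat.mul_le_mul_right n hr
      omega
    · by_cases hv0 : v = (0, 0)
      · subst hv0; rw [G0]; omega
      · rw [Gp r v hv hv0]; omega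
  -- values of `μn`
  have hμnU : ∀ I : Fin 4 → Fin n, μn (ι I) = ∑ r : Fin 4, R ^ (L + (r : ℕ) * n + (n - 1 - (I r : ℕ))) := by
    intro I; simp only [hμn, GU]
  have hμn0 : μn ((0 : Fin m), (0 : Fin m)) = 4 * R ^ (L + 4 * n) := by
    simp only [hμn, G0, Finset.sum_const, Finset.card_univ, Fintype.card_fin, smul_eq_mul]
  have hμnp : ∀ p : Fin m × Fin m, p ∉ Set.range ι → p ≠ (0, 0) → μn p = 4 * R ^ (L - 1 - rm p) := by
    intro p hp hp0
    simp only [hμn, Gp _ p hp hp0, Finset.sum_const, Finset.card_univ, Fintype.card_fin, smul_eq_mul]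
  have hμnle : ∀ v, μn v ≤ 4 * R ^ Q := by
    intro v
    calc μn v = ∑ r, R ^ G r v := rfl
      _ ≤ ∑ _r : Fin 4, R ^ Q := Finset.sum_le_sum fun r _ => Nat.pow_le_pow_right hR0 (hGQ r v).le
      _ = 4 * R ^ Q := by simp
  -- digits of an exponent
  set dig : ℕ → (Fin m × Fin m → ℕ) → ℕ := fun q e =>
    ∑ r : Fin 4, ∑ v ∈ Finset.univ.filter (fun v => G r v = q), e v with hdig
  have hweight : ∀ e : Fin m × Fin m →₀ ℕ,
      Finsupp.weight (fun v => (μn v : ℤ)) e = ((∑ q ∈ Finset.range Q, dig q e * R ^ q : ℕ) : ℤ) := by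
    intro e
    rw [bfba_weight_natCast, wH_weight_eq_digitSum G R Q hGQ]
  have hdiglt : ∀ e : Fin m × Fin m →₀ ℕ, e.degree ≤ m → ∀ q, dig q e < R := by
    intro e he q
    have h1 := wH_digit_le G e q
    rw [Fintype.card_fin, bfba_sum_eq_degree] at h1
    show (∑ r : Fin 4, ∑ v ∈ Finset.univ.filter (fun v => G r v = q), e v) < R
    calc _ ≤ 4 * e.degree := h1
      _ < R := by omega
  -- reading off the digits: slot contents, unused exponents, padding exponent
  have hdigU : ∀ (e : Fin m × Fin m →₀ ℕ) (r : Fin 4) (i : Fin n),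
      dig (L + (r : ℕ) * n + (n - 1 - (i : ℕ))) e =
        ∑ I ∈ Finset.univ.filter (fun I : Fin 4 → Fin n => I r = i), e (ι I) := by
    intro e r i
    have hi := i.isLt
    -- which variables carry this digit
    have hmem : ∀ (r' : Fin 4) (v : Fin m × Fin m), G r' v = L + (r : ℕ) * n + (n - 1 - (i : ℕ)) ↔
        r' = r ∧ ∃ I : Fin 4 → Fin n, I r = i ∧ ι I = v := by
      intro r' v
      constructor
      · intro h
        by_cases hv : v ∈ Set.range ι
        · obtain ⟨I, rfl⟩ := hv
          rw [GU] at h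
          have hr' := r'.isLt; have hr := r.isLt
          have hI := (I r').isLt
          have hrr : (r' : ℕ) = r := by
            rcases lt_trichotomy (r' : ℕ) r with hlt | heq | hgt
            · exfalso
              have h3 : (r' : ℕ) * n + n ≤ (r : ℕ) * n := by
                have := Nat.mul_le_mul_right n (Nat.succ_le_of_lt hlt)
                rwa [Nat.succ_mul] at this
              omega
            · exact heq
            · exfalso
              have h3 : (r : ℕ) * n + n ≤ (r' : ℕ) * n := by
                have := Nat.mul_le_mul_right n (Nat.succ_le_of_lt hgt)
                rwa [Nat.succ_mul] at this
              omega
          have hrr' : r' = r := Fin.ext hrr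
          subst hrr'
          refine ⟨rfl, I, Fin.ext (by omega), rfl⟩
        · exfalso
          by_cases hv0 : v = (0, 0)
          · subst hv0; rw [G0] at h
            have : (r : ℕ) ≤ 3 := Nat.lt_succ_iff.1 r.isLt
            have : (r : ℕ) * n ≤ 3 * n := Nat.mul_le_mul_right n this
            omega
          · rw [Gp r' v hv hv0] at h
            have := hrmL v
            omega
      · rintro ⟨rfl, I, hI, rfl⟩
        rw [GU, hI]
    simp only [hdig]
    rw [Finset.sum_eq_single r]
    · -- the `r`-th inner sum is the slot content
      have hset : (Finset.univ.filter fun v : Fin m × Fin m => G r v = L + (r : ℕ) * n + (n - 1 - (i : ℕ))) =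
          (Finset.univ.filter fun I : Fin 4 → Fin n => I r = i).image ι := by
        ext v
        simp only [Finset.mem_filter, Finset.mem_univ, true_and, Finset.mem_image, hmem]
      rw [hset, Finset.sum_image (fun I _ I' _ h => hι h)]
    · intro r' _ hr'
      refine Finset.sum_eq_zero fun v hv => ?_
      exact absurd ((hmem r' v).1 (Finset.mem_filter.1 hv).2).1 hr'
    · intro h; exact absurd (Finset.mem_univ r) h
  have hdigp : ∀ (e : Fin m × Fin m →₀ ℕ) (p : Fin m × Fin m), p ∉ Set.range ι → p ≠ (0, 0) →
      dig (L - 1 - rm p) e = 4 * e p := by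
    intro e p hp hp0
    have hmem : ∀ (r' : Fin 4) (v : Fin m × Fin m), G r' v = L - 1 - rm p ↔ v = p := by
      intro r' v
      constructor
      · intro h
        by_cases hv : v ∈ Set.range ι
        · obtain ⟨I, rfl⟩ := hv
          rw [GU] at h; have := hrmL p; omega
        · by_cases hv0 : v = (0, 0)
          · subst hv0; rw [G0] at h; have := hrmL p; omega
          · rw [Gp r' v hv hv0] at h
            have h1 := hrmL v; have h2 := hrmL p
            exact bfba_lin_injective v p (by simp only [hrm] at h h1 h2 ⊢; omega)
      · intro hv; rw [hv]; exact Gp r' p hp hp0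
    simp only [hdig]
    have hinner : ∀ r' : Fin 4, ∑ v ∈ Finset.univ.filter (fun v => G r' v = L - 1 - rm p), e v = e p := by
      intro r'
      have hset : (Finset.univ.filter fun v : Fin m × Fin m => G r' v = L - 1 - rm p) = {p} := by
        ext v; simp [hmem]
      rw [hset, Finset.sum_singleton]
    simp only [hinner, Finset.sum_const, Finset.card_univ, Fintype.card_fin, smul_eq_mul]
  have hdig0 : ∀ e : Fin m × Fin m →₀ ℕ, dig (L + 4 * n) e = 4 * e ((0 : Fin m), (0 : Fin m)) := by
    intro e
    have hmem : ∀ (r' : Fin 4) (v : Fin m × Fin m), G r' v = L + 4 * n ↔ v = (0, 0) := by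
      intro r' v
      constructor
      · intro h
        by_cases hv : v ∈ Set.range ι
        · obtain ⟨I, rfl⟩ := hv
          rw [GU] at h
          have : (r' : ℕ) ≤ 3 := Nat.lt_succ_iff.1 r'.isLt
          have : (r' : ℕ) * n ≤ 3 * n := Nat.mul_le_mul_right n this
          have := (I r').isLt
          omega
        · by_cases hv0 : v = (0, 0)
          · exact hv0
          · rw [Gp r' v hv hv0] at h; omega
      · intro hv; rw [hv]; exact G0 r'
    simp only [hdig]
    have hinner : ∀ r' : Fin 4, ∑ v ∈ Finset.univ.filter (fun v => G r' v = L + 4 * n), e v = e (0, 0) := by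
      intro r'
      have hset : (Finset.univ.filter fun v : Fin m × Fin m => G r' v = L + 4 * n) = {((0 : Fin m), (0 : Fin m))} := by
        ext v; simp [hmem]
      rw [hset, Finset.sum_singleton]
    simp only [hinner, Finset.sum_const, Finset.card_univ, Fintype.card_fin, smul_eq_mul]
  -- equal weight in degree `≤ m` ⇒ equal content
  have hcontent : ∀ e e' : Fin m × Fin m →₀ ℕ, e.degree ≤ m → e'.degree ≤ m →
      Finsupp.weight (fun v => (μn v : ℤ)) e = Finsupp.weight (fun v => (μn v : ℤ)) e' →
      (∀ v, v ∉ Set.range ι → e v = e' v) ∧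
      (∀ (r : Fin 4) (i : Fin n),
        ∑ I ∈ Finset.univ.filter (fun I : Fin 4 → Fin n => I r = i), e (ι I) =
          ∑ I ∈ Finset.univ.filter (fun I : Fin 4 → Fin n => I r = i), e' (ι I)) := by
    intro e e' he he' hw
    rw [hweight, hweight] at hw
    have hw' := Int.ofNat_inj.1 hw
    have hd := bfba_digits_inj R hR0 Q (fun q => dig q e) (fun q => dig q e') (hdiglt e he) (hdiglt e' he') hw'
    refine ⟨fun v hv => ?_, fun r i => ?_⟩
    · by_cases hv0 : v = (0, 0)
      · subst hv0
        have h := hd (L + 4 * n) (by omega)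
        rw [hdig0, hdig0] at h
        omega
      · have h := hd (L - 1 - rm v) (by have := hrmL v; omega)
        rw [hdigp e v hv hv0, hdigp e' v hv hv0] at h
        omega
    · have h := hd (L + (r : ℕ) * n + (n - 1 - (i : ℕ))) (by
        have : (r : ℕ) ≤ 3 := Nat.lt_succ_iff.1 r.isLt
        have : (r : ℕ) * n ≤ 3 * n := Nat.mul_le_mul_right n this
        have := i.isLt
        omega)
      rwa [hdigU, hdigU] at h
  -- the weight
  refine ⟨fun v => (μn v : ℤ), fun v => Int.natCast_nonneg _, ?_, ?_, ?_, ?_, ?_, ?_, ?_, ?_⟩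
  · -- (1) injectivity
    refine wH_injective_of_content ι hι _ fun v v' hvv' => ?_
    have hdeg : ∀ u : Fin m × Fin m, (Finsupp.single u 1 : Fin m × Fin m →₀ ℕ).degree ≤ m := fun u => by
      rw [Finsupp.degree_single]; exact hm
    exact hcontent _ _ (hdeg v) (hdeg v') (by rw [bfba_weight_single_one, bfba_weight_single_one]; exact hvv')
  · -- (2)(i) lowering a multi-index raises the weight
    intro I I' hle hne
    rw [Int.ofNat_lt, hμnU, hμnU]
    obtain ⟨r₀, hr₀⟩ : ∃ r, I' r ≠ I r := by
      by_contra h; push Not at h; exact hne (funext fun r => (h r).symm)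
    have hlt₀ : (I' r₀ : ℕ) < I r₀ := lt_of_le_of_ne (hle r₀) (fun h => hr₀ (Fin.ext h))
    refine Finset.sum_lt_sum (fun r _ => Nat.pow_le_pow_right hR0 ?_) ⟨r₀, Finset.mem_univ _, ?_⟩
    · have := hle r; have := (I r).isLt; omega
    · apply Nat.pow_lt_pow_right hR1
      have := (I r₀).isLt; omega
  · -- (2)(ii) unused below used
    intro p hp hp0 I
    rw [Int.ofNat_lt, hμnp p hp hp0, hμnU]
    have h1 : 4 * R ^ (L - 1 - rm p) < R ^ L := by
      calc 4 * R ^ (L - 1 - rm p) ≤ 4 * R ^ (L - 1) :=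
            Nat.mul_le_mul_left 4 (Nat.pow_le_pow_right hR0 (by omega))
        _ < R * R ^ (L - 1) := Nat.mul_lt_mul_of_pos_right (by omega) (Nat.pow_pos hR0)
        _ = R ^ L := by rw [← pow_succ']; congr 1; omega
    have h2 : R ^ L ≤ ∑ r : Fin 4, R ^ (L + (r : ℕ) * n + (n - 1 - (I r : ℕ))) :=
      calc R ^ L ≤ R ^ (L + ((0 : Fin 4) : ℕ) * n + (n - 1 - (I 0 : ℕ))) := Nat.pow_le_pow_right hR0 (by omega)
        _ ≤ ∑ r : Fin 4, R ^ (L + (r : ℕ) * n + (n - 1 - (I r : ℕ))) :=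
          Finset.single_le_sum (f := fun r : Fin 4 => R ^ (L + (r : ℕ) * n + (n - 1 - (I r : ℕ))))
            (fun r _ => Nat.zero_le _) (Finset.mem_univ 0)
    exact lt_of_lt_of_le h1 h2
  · -- (2)(ii') unused below the padding variable
    intro p hp hp0
    rw [Int.ofNat_lt, hμnp p hp hp0, hμn0]
    exact Nat.mul_lt_mul_of_pos_left (Nat.pow_lt_pow_right hR1 (by have := hrmL p; omega)) (by norm_num)
  · -- (2)(iii) decreasing along `p.1 m + p.2` on the unused variables
    intro p q hp hp0 hq hq0 hlt
    rw [Int.ofNat_lt, hμnp p hp hp0, hμnp q hq hq0]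
    refine Nat.mul_lt_mul_of_pos_left (Nat.pow_lt_pow_right hR1 ?_) (by norm_num)
    have h1 := hrmL p; have h2 := hrmL q
    simp only [hrm] at h1 h2 hlt ⊢
    omega
  · -- (3) the padded hyperdeterminant is `μ`-homogeneous
    refine wH_padded_hyperdet_weight ι _ (fun r i => ((R ^ (L + (r : ℕ) * n + (n - 1 - (i : ℕ))) : ℕ) : ℤ))
      fun I => ?_
    show ((μn (ι I) : ℕ) : ℤ) = _
    rw [hμnU]; push_cast; rfl
  · -- (4) genericity: equal weight ⇒ equal character for `H`-diagonal `d`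
    intro e e' he he' hw d _ ht
    obtain ⟨t, ht⟩ := ht
    obtain ⟨hoff, hslot⟩ := hcontent e e' he he' hw
    exact wH_char_eq_of_content ι hι e e' hoff hslot d t ht
  · -- (5) boundedness
    refine ⟨((4 * R ^ Q * m : ℕ) : ℤ), fun e he => ?_⟩
    rw [bfba_weight_natCast]
    exact_mod_cast (calc ∑ v, e v * μn v ≤ ∑ v, e v * (4 * R ^ Q) :=
          Finset.sum_le_sum fun v _ => Nat.mul_le_mul_left _ (hμnle v)
      _ = (∑ v, e v) * (4 * R ^ Q) := (Finset.sum_mul _ _ _).symm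
      _ ≤ m * (4 * R ^ Q) := Nat.mul_le_mul_right _ (by rw [bfba_sum_eq_degree]; exact he)
      _ = 4 * R ^ Q * m := by ring)

end Summit.ValiantsHypothesis.ValiantsHypothesis.Theorems.DetQPDetqpThesis.HdBorelFixed

end
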